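import Summits.BirchSwinnertonDyer.BirchSwinnertonDyer.Theorems.KimAtThreeShallowEqDeepGoodOfDefinedKato
import Summits.BirchSwinnertonDyer.BirchSwinnertonDyer.Theorems.KimAtThreeShallowEqDeepMultOfDefinedKatoRows
import HarnessLib

/-!
# Route `KimAtThreeKolyvagin` (W2): crux 19599's `stub_nonAdditive` VERBATIM, crux 19599 BY NAME and crux 19077 BY NAME
# from the leaves + φ-level DEFINED-KATO packages on every non-additive row — (C1ₑₓ¹ᵘ) [multiplicative rows],
# (C1ₑₓ^τ) [good rows] — + (C1₂) [additive-defect rows] (the OWNER's assembly, third form)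

Cell `bsd-addord`, seat `bsd-addord-w2-c4` (gen 10; OWNER of crux 19599 `ShallowEqDeepOffKatoStratum`, item 19077
`ShallowEqDeepAtTorsionFree`).  `--supports` 19077.  HONEST FRAMING: END THEOREMS WITH DISPLAYED HYPOTHESES (no
definition, no named fact, no instance, no `sorry`); conclusions BY NAME but CONDITIONAL on the route's cite-only leaves
and THREE displayed construction-shaped packages; nothing closed, nothing booked; 19560 / 19599 / 19077 stay OPEN; BSD
is not proved by any of this.

## What (compared with the second form `KimAtThreeShallowEqDeepOffStratumOfDefinedKato`, p510665)
There the good ANOMALOUS rows still displayed gen 9's rider-level package (C1_τ).  Here EVERY non-additive `t = 0` row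
displays a φ-level DEFINED-KATO package of seat w2-c3's shape `(ι, κK, Λ, φ)` + `hker` + `hdual` + ONE crude
compatibility at `b = 1` + `ZetaBody` + R-κ, the compatibility being UNTWISTED on the multiplicative rows
((C1ₑₓ¹ᵘ): «`3·(φ(h)⊗1 − Λy) ∈ 3^{j+1}L_int`», p508464) and TWISTED by the Euler factor at `3` on the good rows
((C1ₑₓ^τ): «`3·(φ(h)⊗1 − Λy) ∈ 3^{j+1}·Tw_{P_w}L_int`», `P_w = 3 − a₃δ_w + δ_{w²}`, this gen's
`KimAtThreeShallowEqDeepGoodOfDefinedKato.fineKatoτ_of_definedKatoTwist`: Kim's Lemma 3.4 from `hdual` + injectivity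
of the twist operator; NO digit lost, anomalous rows included).  Both clauses are TRUE for Kato's `Λ = exp*`
(`3·exp*(H¹(K,T)) ⊆ 𝒪_K` at a multiplicative `3`; `= P(φ⁻¹)𝒪_K` at a good `3` — the LATTICE LEMMA).
* §1 `stub19599_nonAdditive_of_definedKato : [S24](1)(2) → GZK → PT → (C1ₑₓ¹ᵘ)[mult] → (C1ₑₓ^τ)[good] → ⟨stub VERBATIM⟩`.
* §2 `shallowEqDeepOffKatoStratum_of_leaves_of_definedKato : … → (C1₂) → ShallowEqDeepOffKatoStratum` (19599 BY NAME).
* §3 `shallowEqDeepAtTorsionFree_of_leaves_of_definedKato : SakamotoKolyvaginThree → RankEqAnalyticRankLeOne →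
  PoitouTateSelmerDuality → CarayolLevelEqConductor → KatoKuriharaPortThreeShared → (C1ₑₓ¹ᵘ)[mult] → (C1ₑₓ^τ)[good] →
  (C1₂) → ShallowEqDeepAtTorsionFree` (19077 BY NAME).
READING (08-28 residual of record, W2): 19599 / 19077 ⟸ leaves (∧ 19560) ∧ (C1ₑₓ¹ᵘ)[multiplicative t = 0 rows] ∧
(C1ₑₓ^τ)[good t = 0 rows] ∧ (C1₂)[additive-defect rows]; the two non-additive packages are w2-c3's (C1ₑₓ) with `b := 1`,
R-κ, and (good rows) the compatibility read on the Euler-factor lattice.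
References: [BlochKato1990] §3; [Kato2004Asterisque] (8.1.3), §9.4, Thm. 9.7, Ex. 13.3; [Kim2022StructureSelmer] §3.2.3,
Lemma 3.3/3.4, Cor. 3.5, Thm. 3.13, Thm. 1.9 (6); [Kim2025RefinedTNC] Thm 1.1/1.2; [MazurRubin2004] Thm. 4.4.1, 5.2.12,
App. A; [Sakamoto2024] Thm. 4.4; [SilvermanAEC2009] V.1.1, §C.16; memo HOME/w2c4/W2C4-MULT-TWOEXP-g10.md §7.
-/

set_option autoImplicit false
-- the Theorems namespace of a single-conjunct summit repeats the summit name by design (D-0017)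
set_option linter.dupNamespace false

noncomputable section

open scoped NumberField TensorProduct ContRepresentation Classical
open CategoryTheory Field Function Finset IsDedekindDomain NumberField WeierstrassCurve
open Rat.HeightOneSpectrum
open Literature.NumberTheory.GaloisRepresentations Literature.NumberTheory.GaloisCohomology
open Literature.NumberTheory.GaloisRepresentations.DiscreteGaloisModule
open Literature.NumberTheory.EllipticCurves Literature.NumberTheory.EllipticCurves.ModularForms
open Literature.NumberTheory.EllipticCurves.Rank1Residual
open Literature.NumberTheory.EllipticCurves.Kato2004
open Literature.NumberTheory.EllipticCurves.Kato2004.EulerSystemValues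
open Summit.BirchSwinnertonDyer.Rank1Residual.GaloisImage
open Summit.BirchSwinnertonDyer.Rank1Residual.Additive.LocalLog
open Summit.BirchSwinnertonDyer.BirchSwinnertonDyer.Theses.KimAtThreeKolyvagin
open Summit.BirchSwinnertonDyer.BirchSwinnertonDyer.Theorems
open Summit.BirchSwinnertonDyer.BirchSwinnertonDyer.Theorems.KimAtThreeKolyvaginDefs
open Summit.BirchSwinnertonDyer.BirchSwinnertonDyer.Theorems.KimAtThreeShallowEqDeepSplitGlueNoStub
open Summit.BirchSwinnertonDyer.BirchSwinnertonDyer.Theorems.KimAtThreeShallowEqDeepNonAdditiveOfFineKato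
open Summit.BirchSwinnertonDyer.BirchSwinnertonDyer.Theorems.KimAtThreeShallowEqDeepGoodOfDefinedKato

namespace Summit.BirchSwinnertonDyer.BirchSwinnertonDyer.Theorems.KimAtThreeShallowEqDeepOffStratumOfDefinedKatoAll

/-! ### The displayed packages (local notation) -/

/-- Local notation: the TWO-EXPONENT rider clause (ii₂) at depth `j`, torsion slot `t`, defect exponent `e`,
place `v`, for the pair `(Λ, Λf)` (seat acc6's RIDER₂, VERBATIM). -/
local notation3 (prettyPrint := false) "RIDER₂⟦" W' ", " j ", " t' ", " e' ", " v' ", " Λ' ", " Λf "⟧" =>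
  ∀ (r : Finset (HeightOneSpectrum (𝓞 ℚ)))
    (Ψ : H1 (tateRep W' 3) (cycSubgroup 3 0 r) →+
      continuousCohomology 1
        (subgroupRep (WeierstrassCurve.torsionGaloisModule W' (((3 : ℕ) : ℤ) ^ j * ((3 : ℕ) : ℤ))).toTopRep
          (cycSubgroup 3 0 r))),
    (∀ (φ : contOneCocycles (subgroupRep (tateRep W' 3).toTopRep (cycSubgroup 3 0 r)))
        (ψ : contOneCocycles
          (subgroupRep (WeierstrassCurve.torsionGaloisModule W' (((3 : ℕ) : ℤ) ^ j * ((3 : ℕ) : ℤ))).toTopRep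
            (cycSubgroup 3 0 r))),
        (∀ g, ((ψ.1 g : geomTorsion W' (((3 : ℕ) : ℤ) ^ j * ((3 : ℕ) : ℤ))) : geomPoints W') =
          TateModule.proj 3 (j + 1) (φ.1 g)) →
        Ψ (oneCocycleClass _ φ) = oneCocycleClass _ ψ) →
    ∀ (y : H1 (tateRep W' 3) (cycSubgroup 3 0 r))
      (κ₀ : galoisCohomology (WeierstrassCurve.torsionGaloisModule W' (((3 : ℕ) : ℤ) ^ j * ((3 : ℕ) : ℤ))) 1)
      (s : ℤ_[3]),
      resSubgroup (WeierstrassCurve.torsionGaloisModule W' (((3 : ℕ) : ℤ) ^ j * ((3 : ℕ) : ℤ))).toTopRep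
          (cycSubgroup 3 0 r) 1 κ₀ = Ψ y →
      galoisCohomology.localization (WeierstrassCurve.torsionGaloisModule W' (((3 : ℕ) : ℤ) ^ j * ((3 : ℕ) : ℤ)))
          (Sum.inr v') 1 κ₀ ∈ propagatedSelmerStructure W' 3 j (Sum.inr v') →
      (∃ l ∈ cycIntLattice 3 (cycLevel 3 0 r),
          (((3 : ℕ) : ℤ_[3]) ^ t') • Λ' 0 r y - ((s : ℚ_[3]) ⊗ₜ[ℚ] (1 : CyclotomicField (cycLevel 3 0 r) ℚ)) =
            (((3 : ℕ) : ℤ_[3]) ^ (j + 1)) • (l : ℚ_[3] ⊗[ℚ] CyclotomicField (cycLevel 3 0 r) ℚ)) →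
      ((3 ^ e' : ℕ) : ZMod (3 ^ (j + 1))) *
        Λf (galoisCohomology.localization
          (WeierstrassCurve.torsionGaloisModule W' (((3 : ℕ) : ℤ) ^ j * ((3 : ℕ) : ℤ))) (Sum.inr v') 1 κ₀) =
        PadicInt.toZModPow (j + 1) s

/-- Local notation: Kato's `ZetaBody` FAMILY for `(ι, κK, Λ)` and the cusp form `f'` at level `N'`. -/
local notation3 (prettyPrint := false) "ZBODY⟦" W' ", " N' ", " f' ", " ι' ", " κ' ", " Λ' "⟧" =>
  ∀ (c d a : ℤ) (A : ℕ), 0 < A → Int.gcd c (6 * 3 * A) = 1 → Int.gcd d (6 * 3 * N') = 1 →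
    ∃ (z : ∀ (k' : ℕ) (r : (cyclotomicLevelsRat 3 (badPlaces c d A N')).Ideals),
          H1 (tateRep W' 3) ((cyclotomicLevelsRat 3 (badPlaces c d A N')).level k' r.1))
      (x : ∀ (k' : ℕ) (r : (cyclotomicLevelsRat 3 (badPlaces c d A N')).Ideals),
          CyclotomicField (cycLevel 3 k' r.1) ℚ),
      ZetaBody W' 3 f' ι' κ' Λ' c d a A z x

/-- Local notation: the TWISTED compatibility COMPAT_τ at depth `j` between `Λ_{0,r}` and `φ` (place `v`, model
`t₃`): «`3•(φ(h) ⊗ 1 − Λ_{0,r}(y)) ∈ 3^{j+1}·Tw_{P_w} L_int`» for every `T`-lift `h` of `loc_v κ₀`, `res κ₀ = Ψ y`,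
and every `w` with `w·[3] = 1`. -/
local notation3 (prettyPrint := false) "COMPATτ⟦" W' ", " j ", " v' ", " t3 ", " Λ' ", " φ0 "⟧" =>
  ∀ (r : Finset (HeightOneSpectrum (𝓞 ℚ))) (w : (ZMod (cycLevel 3 0 r))ˣ),
    (w : ZMod (cycLevel 3 0 r)) * ((3 : ℕ) : ZMod (cycLevel 3 0 r)) = 1 →
    ∀ (Ψ : H1 (tateRep W' 3) (cycSubgroup 3 0 r) →+
      continuousCohomology 1 (subgroupRep
        (WeierstrassCurve.torsionGaloisModule W' (((3 : ℕ) : ℤ) ^ j * ((3 : ℕ) : ℤ))).toTopRep (cycSubgroup 3 0 r))),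
    (∀ (φ₁ : contOneCocycles (subgroupRep (tateRep W' 3).toTopRep (cycSubgroup 3 0 r)))
        (ψ : contOneCocycles (subgroupRep
          (WeierstrassCurve.torsionGaloisModule W' (((3 : ℕ) : ℤ) ^ j * ((3 : ℕ) : ℤ))).toTopRep (cycSubgroup 3 0 r))),
        (∀ g, ((ψ.1 g : geomTorsion W' (((3 : ℕ) : ℤ) ^ j * ((3 : ℕ) : ℤ))) : geomPoints W') =
          TateModule.proj 3 (j + 1) (φ₁.1 g)) →
        Ψ (oneCocycleClass _ φ₁) = oneCocycleClass _ ψ) →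
    ∀ (y : H1 (tateRep W' 3) (cycSubgroup 3 0 r))
      (κ₀ : galoisCohomology (WeierstrassCurve.torsionGaloisModule W' (((3 : ℕ) : ℤ) ^ j * ((3 : ℕ) : ℤ))) 1)
      (h : (tateLocalRep W' 3 (Sum.inr v')).cohomology 1),
      resSubgroup (WeierstrassCurve.torsionGaloisModule W' (((3 : ℕ) : ℤ) ^ j * ((3 : ℕ) : ℤ))).toTopRep
          (cycSubgroup 3 0 r) 1 κ₀ = Ψ y →
      galoisCohomology.localization (WeierstrassCurve.torsionGaloisModule W' (((3 : ℕ) : ℤ) ^ j * ((3 : ℕ) : ℤ)))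
          (Sum.inr v') 1 κ₀ = tateLocalMap W' 3 j (Sum.inr v') h →
      ∃ l ∈ cycIntLattice 3 (cycLevel 3 0 r),
        ((3 : ℕ) : ℤ_[3]) • ((φ0 h ⊗ₜ[ℚ] (1 : CyclotomicField (cycLevel 3 0 r) ℚ)) - Λ' 0 r y) =
          ((3 : ℤ_[3]) ^ (j + 1)) • ∑ g : (ZMod (cycLevel 3 0 r))ˣ,
            ((((((3 : ℕ) : MonoidAlgebra ℤ_[3] (ZMod (cycLevel 3 0 r))ˣ)) -
                MonoidAlgebra.single w (t3 : ℤ_[3]) +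
                MonoidAlgebra.single (w ^ 2) (1 : ℤ_[3])).coeff g : ℤ_[3]) : ℚ_[3]) •
              Algebra.TensorProduct.map (AlgHom.id ℚ ℚ_[3])
                (sigma (cycLevel 3 0 r) g : CyclotomicField (cycLevel 3 0 r) ℚ →ₐ[ℚ]
                  CyclotomicField (cycLevel 3 0 r) ℚ) l

/-- Local notation: the crude compatibility X1-int at depth `j` WITH EXPONENT `b := 1` between Kato's value datum
`Λ_{0,r}` and the scalar dual exponential `φ` at `v` (seat w2-c3's X1-int_b text with `b = 1`). -/
local notation3 (prettyPrint := false) "COMPAT₁⟦" W' ", " j ", " v' ", " Λ' ", " φ0 "⟧" =>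
  ∀ (r : Finset (HeightOneSpectrum (𝓞 ℚ)))
    (Ψ : H1 (tateRep W' 3) (cycSubgroup 3 0 r) →+
      continuousCohomology 1 (subgroupRep
        (WeierstrassCurve.torsionGaloisModule W' (((3 : ℕ) : ℤ) ^ j * ((3 : ℕ) : ℤ))).toTopRep (cycSubgroup 3 0 r))),
    (∀ (φ₁ : contOneCocycles (subgroupRep (tateRep W' 3).toTopRep (cycSubgroup 3 0 r)))
        (ψ : contOneCocycles (subgroupRep
          (WeierstrassCurve.torsionGaloisModule W' (((3 : ℕ) : ℤ) ^ j * ((3 : ℕ) : ℤ))).toTopRep (cycSubgroup 3 0 r))),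
        (∀ g, ((ψ.1 g : geomTorsion W' (((3 : ℕ) : ℤ) ^ j * ((3 : ℕ) : ℤ))) : geomPoints W') =
          TateModule.proj 3 (j + 1) (φ₁.1 g)) →
        Ψ (oneCocycleClass _ φ₁) = oneCocycleClass _ ψ) →
    ∀ (y : H1 (tateRep W' 3) (cycSubgroup 3 0 r))
      (κ₀ : galoisCohomology (WeierstrassCurve.torsionGaloisModule W' (((3 : ℕ) : ℤ) ^ j * ((3 : ℕ) : ℤ))) 1)
      (h : (tateLocalRep W' 3 (Sum.inr v')).cohomology 1),
      resSubgroup (WeierstrassCurve.torsionGaloisModule W' (((3 : ℕ) : ℤ) ^ j * ((3 : ℕ) : ℤ))).toTopRep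
          (cycSubgroup 3 0 r) 1 κ₀ = Ψ y →
      galoisCohomology.localization (WeierstrassCurve.torsionGaloisModule W' (((3 : ℕ) : ℤ) ^ j * ((3 : ℕ) : ℤ)))
          (Sum.inr v') 1 κ₀ = tateLocalMap W' 3 j (Sum.inr v') h →
      ∃ l ∈ cycIntLattice 3 (cycLevel 3 0 r),
        (((3 : ℕ) : ℤ_[3]) ^ (1 : ℕ)) • ((φ0 h ⊗ₜ[ℚ] (1 : CyclotomicField (cycLevel 3 0 r) ℚ)) - Λ' 0 r y) =
          (((3 : ℕ) : ℤ_[3]) ^ (j + 1)) • (l : ℚ_[3] ⊗[ℚ] CyclotomicField (cycLevel 3 0 r) ℚ)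

/-- Local notation: **(C1ₑₓ¹ᵘ) at the row `(W, v, P)`** — seat w2-c3's DEFINED-KATO package (C1ₑₓ) with the crude
exponent FIXED to `b = 1` and R-κ added: `(ι, κK, Λ, φ)` with `κK ≠ 0` a rational `3`-adic unit, `hker`, `hdual`,
COMPAT₁ at every depth, and Kato's `ZetaBody` family for `P.f`. -/
local notation3 (prettyPrint := false) "DEFKATO₁ᵘ⟦" W' ", " v' ", " N' ", " P' "⟧" =>
  ∃ (ι : (n : ℕ) → (CyclotomicField n ℚ →+* ℂ)) (κK : ℝ)
    (Λ : ∀ (k' : ℕ) (r : Finset (HeightOneSpectrum (𝓞 ℚ))),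
      H1 (tateRep W' 3) (cycSubgroup 3 k' r) →ₗ[ℤ_[3]] ℚ_[3] ⊗[ℚ] CyclotomicField (cycLevel 3 k' r) ℚ)
    (φ : (tateLocalRep W' 3 (Sum.inr v')).cohomology 1 →+ ℚ_[3]),
    κK ≠ 0 ∧ (∃ u : ℚ, (u : ℝ) = κK ∧ padicValRat 3 u = 0) ∧
    (∀ y, φ y = 0 ↔ ∀ j : ℕ, tateLocalMap W' 3 j (Sum.inr v') y ∈
      WeierstrassCurve.kummerSelmerStructure W' (((3 : ℕ) : ℤ) ^ j * ((3 : ℕ) : ℤ)) (Sum.inr v')) ∧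
    (∀ a : ℚ_[3], (∃ y, φ y = a) ↔
      ∀ Q : ((W' : WeierstrassCurve ℚ).baseChange ℚ_[3]).toAffine.Point,
        ‖a * padicLog ((W' : WeierstrassCurve ℚ).baseChange ℚ_[3]) Q‖ ≤ 1) ∧
    (∀ j : ℕ, COMPAT₁⟦W', j, v', Λ, φ⟧) ∧
    ∀ (c d a : ℤ) (A : ℕ), 0 < A → Int.gcd c (6 * 3 * A) = 1 → Int.gcd d (6 * 3 * N') = 1 →
      ∃ (z : ∀ (k' : ℕ) (r : (cyclotomicLevelsRat 3 (badPlaces c d A N')).Ideals),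
            H1 (tateRep W' 3) ((cyclotomicLevelsRat 3 (badPlaces c d A N')).level k' r.1))
        (x : ∀ (k' : ℕ) (r : (cyclotomicLevelsRat 3 (badPlaces c d A N')).Ideals),
            CyclotomicField (cycLevel 3 k' r.1) ℚ),
        ZetaBody W' 3 (P' : ModularParametrizationData W' N').f ι κK Λ c d a A z x

/-- Local notation: **(C1ₑₓ^τ) at the row `(W, v, P)` with integer model `t₃` of `a₃`** — the DEFINED-KATO package with the
TWISTED (Euler-factor) compatibility: `(ι, κK, Λ, φ)` with `κK ≠ 0` a rational `3`-adic unit, `hker`, `hdual`, COMPAT_τ at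
every depth, and Kato's `ZetaBody` family for `P.f`. -/
local notation3 (prettyPrint := false) "DEFKATOτ⟦" W' ", " v' ", " N' ", " P' ", " t3 "⟧" =>
  ∃ (ι : (n : ℕ) → (CyclotomicField n ℚ →+* ℂ)) (κK : ℝ)
    (Λ : ∀ (k' : ℕ) (r : Finset (HeightOneSpectrum (𝓞 ℚ))),
      H1 (tateRep W' 3) (cycSubgroup 3 k' r) →ₗ[ℤ_[3]] ℚ_[3] ⊗[ℚ] CyclotomicField (cycLevel 3 k' r) ℚ)
    (φ : (tateLocalRep W' 3 (Sum.inr v')).cohomology 1 →+ ℚ_[3]),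
    κK ≠ 0 ∧ (∃ u : ℚ, (u : ℝ) = κK ∧ padicValRat 3 u = 0) ∧
    (∀ y, φ y = 0 ↔ ∀ j : ℕ, tateLocalMap W' 3 j (Sum.inr v') y ∈
      WeierstrassCurve.kummerSelmerStructure W' (((3 : ℕ) : ℤ) ^ j * ((3 : ℕ) : ℤ)) (Sum.inr v')) ∧
    (∀ a : ℚ_[3], (∃ y, φ y = a) ↔
      ∀ Q : ((W' : WeierstrassCurve ℚ).baseChange ℚ_[3]).toAffine.Point,
        ‖a * padicLog ((W' : WeierstrassCurve ℚ).baseChange ℚ_[3]) Q‖ ≤ 1) ∧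
    (∀ j : ℕ, COMPATτ⟦W', j, v', t3, Λ, φ⟧) ∧
    ZBODY⟦W', N', (P' : ModularParametrizationData W' N').f, ι, κK, Λ⟧

/-- Local notation: **(C1₂) ON THE ADDITIVE-DEFECT ROWS** — seat acc3's FINEKATO₂
(`KimAtThreeOffStratumAdditiveDefectOfFineKato`), VERBATIM. -/
local notation3 (prettyPrint := false) "PKG₂_DEFECT" =>
  ∀ (W : WeierstrassCurve ℚ) [W.IsElliptic] [W.IsGloballyMinimal]
    [ContinuousSMul ℤ_[3] (W.tateModule 3)] [Module.Free ℤ_[3] (W.tateModule 3)]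
    [Module.Finite ℤ_[3] (W.tateModule 3)],
    (∀ m : ℕ, W.HasSurjectiveModNGaloisRep (3 ^ m : ℕ)) →
    (haveI : Fact (Nat.Prime 3) := ⟨Nat.prime_three⟩; Addv W 3) →
    Nat.card {Q : (W.baseChange ℚ_[3]).toAffine.Point // (3 : ℕ) • Q = 0} = 1 →
    ∀ (v₃ : HeightOneSpectrum (𝓞 ℚ)), ((3 : ℕ) : 𝓞 ℚ) ∈ v₃.asIdeal →
    ∀ {N : ℕ} [NeZero N] (P : ModularParametrizationData W N), N = W.conductorNorm ℤ →
      (∀ z ∈ P.L.lattice, ∃ w ∈ periodLattice P.f, z = P.c * w) →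
      (3 ∣ (W.baseChange ℚ_[3]).localTamagawaNumber ℤ_[3] ∨ (3 : ℤ) ∣ P.maninConstant) →
      ∃ (ι : (n : ℕ) → (CyclotomicField n ℚ →+* ℂ)) (κK : ℝ)
        (Λ : ∀ (k' : ℕ) (r : Finset (HeightOneSpectrum (𝓞 ℚ))),
          H1 (tateRep W 3) (cycSubgroup 3 k' r) →ₗ[ℤ_[3]]
            ℚ_[3] ⊗[ℚ] CyclotomicField (cycLevel 3 k' r) ℚ)
        (Λfin : ∀ j : ℕ, galoisCohomology
          ((W.torsionGaloisModule (((3 : ℕ) : ℤ) ^ j * ((3 : ℕ) : ℤ))).toLocal (Sum.inr v₃)) 1 →+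
            ZMod (3 ^ (j + 1))) (e : ℕ),
        κK ≠ 0 ∧ (∃ u : ℚ, (u : ℝ) = κK ∧ padicValRat 3 u = 0) ∧
        (∀ j : ℕ,
          (∀ c : ZMod (3 ^ (j + 1)), ∃ x ∈ propagatedSelmerStructure W 3 j (Sum.inr v₃), Λfin j x = c) ∧
          (∀ x ∈ propagatedSelmerStructure W 3 j (Sum.inr v₃),
            Λfin j x = 0 ↔ x ∈ W.kummerSelmerStructure (((3 : ℕ) : ℤ) ^ j * ((3 : ℕ) : ℤ)) (Sum.inr v₃))) ∧
        (∀ j : ℕ, RIDER₂⟦W, j, 0, e, v₃, Λ, Λfin j⟧) ∧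
        ∀ (c d a : ℤ) (A : ℕ), 0 < A → Int.gcd c (6 * 3 * A) = 1 → Int.gcd d (6 * 3 * N) = 1 →
          ∃ (z : ∀ (k' : ℕ) (r : (cyclotomicLevelsRat 3 (badPlaces c d A N)).Ideals),
                H1 (tateRep W 3) ((cyclotomicLevelsRat 3 (badPlaces c d A N)).level k' r.1))
            (x : ∀ (k' : ℕ) (r : (cyclotomicLevelsRat 3 (badPlaces c d A N)).Ideals),
                CyclotomicField (cycLevel 3 k' r.1) ℚ),
            ZetaBody W 3 P.f ι κK Λ c d a A z x

/-- Local notation: the `stub_nonAdditive` signature of crux 19599 (BC3 birth skeleton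
`Cruxes/ShallowEqDeepOffKatoStratum/Lines/birth.lean`), VERBATIM. -/
local notation3 (prettyPrint := false) "STUB19599NA" =>
  ∀ (W₀ : WeierstrassCurve ℚ) [W₀.IsElliptic] [W₀.IsGloballyMinimal],
    (∀ n : ℕ, W₀.HasSurjectiveModNGaloisRep (3 ^ n : ℕ)) →
    Nat.card {Q : (W₀.baseChange ℚ_[3]).toAffine.Point // (3 : ℕ) • Q = 0} = 1 → Finite W₀.sha →
    ∀ {N : ℕ} [NeZero N], N = W₀.conductorNorm ℤ →
    ∀ (D₀ : Literature.NumberTheory.EllipticCurves.ModularForms.ModularParametrizationData W₀ N),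
      (∀ z ∈ D₀.L.lattice, ∃ w ∈ Literature.NumberTheory.EllipticCurves.ModularForms.periodLattice D₀.f, z = D₀.c * w) →
      (∀ (W₂ : WeierstrassCurve ℚ) [W₂.IsElliptic]
        (D₂ : Literature.NumberTheory.EllipticCurves.ModularForms.ModularParametrizationData W₂ N),
        D₂.f = D₀.f → D₀.modularDegree ≤ D₂.modularDegree) →
      (∀ r : ℚ, Literature.NumberTheory.EllipticCurves.ratPlusSymbol D₀.f r ≠ 0 →
        0 ≤ padicValRat 3 (Literature.NumberTheory.EllipticCurves.ratPlusSymbol D₀.f r)) →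
      Literature.NumberTheory.EllipticCurves.kuriharaVanishingOrder W₀ 3 D₀.f = 0 →
      ¬ (haveI : Fact (Nat.Prime 3) := ⟨Nat.prime_three⟩;
          Literature.NumberTheory.EllipticCurves.Rank1Residual.Addv W₀ 3) →
      Literature.NumberTheory.EllipticCurves.kuriharaPartialDeepInfty W₀ 3 D₀.f ≤
        Literature.NumberTheory.EllipticCurves.kuriharaPartialInfty W₀ 3 D₀.f

/-- Local notation: **(C1ₑₓ¹ᵘ) ON THE MULTIPLICATIVE ROWS** (binders of `stub_nonAdditive` + `Mult W₀ 3`). -/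
local notation3 (prettyPrint := false) "PKG_EX1U_MULT" =>
  ∀ (W₀ : WeierstrassCurve ℚ) [W₀.IsElliptic] [W₀.IsGloballyMinimal],
    (∀ n : ℕ, W₀.HasSurjectiveModNGaloisRep (3 ^ n : ℕ)) →
    Nat.card {Q : (W₀.baseChange ℚ_[3]).toAffine.Point // (3 : ℕ) • Q = 0} = 1 →
    ∀ {N : ℕ} [NeZero N], N = W₀.conductorNorm ℤ →
    ∀ (D₀ : ModularParametrizationData W₀ N),
      (∀ z ∈ D₀.L.lattice, ∃ w ∈ periodLattice D₀.f, z = D₀.c * w) →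
      (∀ (W₂ : WeierstrassCurve ℚ) [W₂.IsElliptic] (D₂ : ModularParametrizationData W₂ N),
        D₂.f = D₀.f → D₀.modularDegree ≤ D₂.modularDegree) →
      W₀.HasMultiplicativeReductionAtPrime 3 →
    ∀ (v₃ : HeightOneSpectrum (𝓞 ℚ)), ((3 : ℕ) : 𝓞 ℚ) ∈ v₃.asIdeal →
    ∀ [ContinuousSMul ℤ_[3] (WeierstrassCurve.tateModule W₀ 3)] [Module.Free ℤ_[3] (WeierstrassCurve.tateModule W₀ 3)]
      [Module.Finite ℤ_[3] (WeierstrassCurve.tateModule W₀ 3)],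
      DEFKATO₁ᵘ⟦W₀, v₃, N, D₀⟧

/-- Local notation: **(C1ₑₓ^τ) ON THE GOOD ROWS** (binders of `stub_nonAdditive` + `3 ∤ N` + an integer model `t₃` of
`a₃`). -/
local notation3 (prettyPrint := false) "PKG_EXτ_GOOD" =>
  ∀ (W₀ : WeierstrassCurve ℚ) [W₀.IsElliptic] [W₀.IsGloballyMinimal],
    (∀ n : ℕ, W₀.HasSurjectiveModNGaloisRep (3 ^ n : ℕ)) →
    Nat.card {Q : (W₀.baseChange ℚ_[3]).toAffine.Point // (3 : ℕ) • Q = 0} = 1 →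
    ∀ {N : ℕ} [NeZero N], N = W₀.conductorNorm ℤ →
    ∀ (D₀ : ModularParametrizationData W₀ N),
      (∀ z ∈ D₀.L.lattice, ∃ w ∈ periodLattice D₀.f, z = D₀.c * w) →
      (∀ (W₂ : WeierstrassCurve ℚ) [W₂.IsElliptic] (D₂ : ModularParametrizationData W₂ N),
        D₂.f = D₀.f → D₀.modularDegree ≤ D₂.modularDegree) →
      ¬ 3 ∣ N →
    ∀ (v₃ : HeightOneSpectrum (𝓞 ℚ)), ((3 : ℕ) : 𝓞 ℚ) ∈ v₃.asIdeal →
    ∀ (t₃ : ℤ), cuspCoeff D₀.f 3 = t₃ →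
    ∀ [ContinuousSMul ℤ_[3] (WeierstrassCurve.tateModule W₀ 3)] [Module.Free ℤ_[3] (WeierstrassCurve.tateModule W₀ 3)]
      [Module.Finite ℤ_[3] (WeierstrassCurve.tateModule W₀ 3)],
      DEFKATOτ⟦W₀, v₃, N, D₀, t₃⟧

/-! ### §1 `stub_nonAdditive` of crux 19599 from PUB + the two defined-Kato packages -/

set_option backward.isDefEq.respectTransparency false in
/-- **`stub_nonAdditive` of crux 19599 (BC3 birth skeleton, VERBATIM) from the published leaves and the φ-level
DEFINED-KATO packages (C1ₑₓ¹ᵘ)[multiplicative rows] and (C1ₑₓ^τ)[good rows] ALONE.**  Dispatch by the reduction type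
at `3`: good (`3 ∤ N`; this gen's `fineKatoτ_of_definedKatoTwist` then gen 9's `shallowEqDeep_row_of_fineKatoτ_of_good`)
or multiplicative (`a₃ = ±1` so non-anomalous; gen 10's `shallowEqDeep_row_of_definedKatoUnit_of_nonanomalous`).
Nothing booked. [cite: Kim2025RefinedTNC, Thm 1.2] [cite: Kim2022StructureSelmer, Thm. 1.9 (6), §3.2.3, Lemma 3.3/3.4, Thm. 3.13]
[cite: Sakamoto2024, Thm. 4.4 (p. 926)] [cite: MazurRubin2004, Thm. 5.2.12] [cite: BlochKato1990, §3 (Prop. 3.8, Ex. 3.11)]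
[cite: SilvermanAEC2009, Thm. V.1.1 and §C.16] -/
theorem stub19599_nonAdditive_of_definedKato
    (hS24 : Sakamoto2024.kolyvaginSystems_freeRankOne_zmod_three_pow)
    (hS24₂ : Sakamoto2024.kolyvaginSystems_idealOfBasis_eq_fittingIdeal_zmod_three_pow)
    (hGZK : rank_eq_analyticRank_of_analyticRank_le_one) (hPT : poitouTate_selmerStructure_duality ℚ)
    (hEXm : PKG_EX1U_MULT) (hEXg : PKG_EXτ_GOOD) : STUB19599NA := by
  intro W₀ _ _ htow ht _ N _ hN D₀ hopt hdeg hint hord hA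
  obtain ⟨v₃, η, hv₃, hη⟩ := exists_place_three_and_generators
  have hf := D₀.isNewformOf
  by_cases hgood : W₀.HasGoodReductionAtPrime 3
  · have hN3 : ¬ 3 ∣ N := by
      rw [hN]
      exact not_dvd_conductorNorm_of_hasGoodReductionAtPrime W₀ hgood
    exact KimAtThreeShallowEqDeepAnomalousRows.shallowEqDeep_row_of_fineKatoτ_of_good W₀ hS24 hS24₂ hGZK hPT
      htow ht D₀ hN hint hord v₃ hv₃ η hη (hf.2 3) hN3
      (fineKatoτ_of_definedKatoTwist W₀ D₀ hgood ht (hf.2 3)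
        (hEXg W₀ htow ht hN D₀ hopt hdeg hN3 v₃ hv₃ (W₀.LFunction 3) (hf.2 3)))
  · have hmult : W₀.HasMultiplicativeReductionAtPrime 3 := by
      by_contra hm
      exact hA ⟨hgood, hm⟩
    have h3N : 3 ∣ N := by
      by_contra h3N
      rw [hN] at h3N
      exact hgood (hasGoodReductionAtPrime_three_of_not_dvd_conductorNorm W₀ h3N)
    by_cases hsplit : W₀.HasSplitMultiplicativeReductionAtPrime 3
    · have ht₃ : cuspCoeff D₀.f 3 = ((1 : ℤ) : ℂ) := by
        rw [(hf.cuspCoeff_eq_one_and_sq_of_split hsplit).1, Int.cast_one]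
      have h3a : ¬ (3 : ℤ) ∣ 3 + (if 3 ∣ N then 0 else 1) - (1 : ℤ) := by
        rw [if_pos h3N]; decide
      exact KimAtThreeShallowEqDeepMultOfDefinedKatoRows.shallowEqDeep_row_of_definedKatoUnit_of_nonanomalous W₀
        hS24 hS24₂ hGZK hPT htow ht D₀ hN hint hord v₃ hv₃ η hη ht₃ h3a (hEXm W₀ htow ht hN D₀ hopt hdeg hmult v₃ hv₃)
    · have ht₃ : cuspCoeff D₀.f 3 = ((-1 : ℤ) : ℂ) := by
        rw [(hf.cuspCoeff_eq_neg_one_and_dvd_of_nonsplit hmult hsplit).1, Int.cast_neg, Int.cast_one]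
      have h3a : ¬ (3 : ℤ) ∣ 3 + (if 3 ∣ N then 0 else 1) - (-1 : ℤ) := by
        rw [if_pos h3N]; decide
      exact KimAtThreeShallowEqDeepMultOfDefinedKatoRows.shallowEqDeep_row_of_definedKatoUnit_of_nonanomalous W₀
        hS24 hS24₂ hGZK hPT htow ht D₀ hN hint hord v₃ hv₃ η hη ht₃ h3a (hEXm W₀ htow ht hN D₀ hopt hdeg hmult v₃ hv₃)

/-! ### §2 Crux 19599 BY NAME -/

/-- **Crux 19599 `ShallowEqDeepOffKatoStratum` BY NAME ⟸ [S24] (1)(2) ∧ GZK ∧ Poitou–Tate ∧ (C1ₑₓ¹ᵘ)[mult] ∧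
(C1ₑₓ^τ)[good] ∧ (C1₂)[additive defect]** — the birth composition on §1 and seat acc3's `stub19599_additiveDefect_of_fineKato`.
CONDITIONAL; nothing booked. [cite: Kim2025RefinedTNC, Thm 1.1, Thm 1.2] [cite: Kim2022StructureSelmer, Thm. 1.9 (6), Thm. 3.13]
[cite: Sakamoto2024, Thm. 4.4 (p. 926)] [cite: MazurRubin2004, Thm. 4.4.1 and Thm. 5.2.12] -/
theorem shallowEqDeepOffKatoStratum_of_leaves_of_definedKato
    (hS24 : Sakamoto2024.kolyvaginSystems_freeRankOne_zmod_three_pow)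
    (hS24₂ : Sakamoto2024.kolyvaginSystems_idealOfBasis_eq_fittingIdeal_zmod_three_pow)
    (hGZK : rank_eq_analyticRank_of_analyticRank_le_one) (hPT : poitouTate_selmerStructure_duality ℚ)
    (hEXm : PKG_EX1U_MULT) (hEXg : PKG_EXτ_GOOD) (hC1₂ : PKG₂_DEFECT) :
    ShallowEqDeepOffKatoStratum := by
  intro W₀ _ _ htow ht hfin N _ hN D₀ hopt hdeg hint hord hoff
  by_cases hA : (haveI : Fact (Nat.Prime 3) := ⟨Nat.prime_three⟩; Addv W₀ 3)
  · refine KimAtThreeOffStratumAdditiveDefectOfFineKato.stub19599_additiveDefect_of_fineKato hS24 hS24₂ hGZK hPT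
      hC1₂ W₀ htow ht hfin hN D₀ hopt hdeg hint hord hA ?_
    by_contra hcon
    push Not at hcon
    exact hoff ⟨hA, hcon.1, hcon.2⟩
  · exact stub19599_nonAdditive_of_definedKato hS24 hS24₂ hGZK hPT hEXm hEXg W₀ htow ht hfin hN D₀ hopt hdeg hint
      hord hA

/-! ### §3 Crux 19077 BY NAME -/

/-- **Crux 19077 `ShallowEqDeepAtTorsionFree` BY NAME ⟸ the route's four published leaves ∧ crux 19560
`KatoKuriharaPortThreeShared` ∧ (C1ₑₓ¹ᵘ)[mult] ∧ (C1ₑₓ^τ)[good] ∧ (C1₂)[additive defect]** — gen 4's stub-free glue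
`shallowEqDeepAtTorsionFree_of_parts_noStub` on §2.  CONDITIONAL; nothing booked; 19077 stays OPEN.
[cite: Kim2025RefinedTNC, Thm 1.2] [cite: Kim2022StructureSelmer, Thm. 1.9 (6), Thm. 3.13]
[cite: Sakamoto2024, Thm. 4.4 (p. 926)] [cite: MazurRubin2004, Thm. 4.4.1 and Thm. 5.2.12] [cite: Carayol1986] -/
theorem shallowEqDeepAtTorsionFree_of_leaves_of_definedKato
    (hSak : SakamotoKolyvaginThree) (hGZK : RankEqAnalyticRankLeOne) (hPT : PoitouTateSelmerDuality)
    (hlev : CarayolLevelEqConductor) (hPort : KatoKuriharaPortThreeShared)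
    (hEXm : PKG_EX1U_MULT) (hEXg : PKG_EXτ_GOOD) (hC1₂ : PKG₂_DEFECT) :
    ShallowEqDeepAtTorsionFree :=
  shallowEqDeepAtTorsionFree_of_parts_noStub hSak hGZK hPT hlev hPort
    (shallowEqDeepOffKatoStratum_of_leaves_of_definedKato hSak.1 hSak.2 hGZK hPT hEXm hEXg hC1₂)

end Summit.BirchSwinnertonDyer.BirchSwinnertonDyer.Theorems.KimAtThreeShallowEqDeepOffStratumOfDefinedKatoAll

end
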